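import Mathlib
import HarnessLib
import Literature.Geometry.Lorentzian.KerrConvergence
import Literature.Geometry.Lorentzian.QuasiFinalStateDecomposition
import Summits.FinalStateConjecture.FinalStateConjecture.Statement

/-!
# Route LogTimeThreeAnnuli — crux `DyadicCapture`, line `registered`: the same-parameter honest rechart

Helper for the stub `stub_honestRechart` of the skeleton of the crux
`Summit.FinalStateConjecture.FinalStateConjecture.Theses.LogTimeThreeAnnuli.DyadicCapture`
(stmt-FinalStateConjecture-17488, line `registered`, file `Lines/birth.lean`).

The registered stub asks: an honest subconvergent final era over a reference chart system
`d : QuasiFinalStateDecomposition 𝒟.toSpacetime O 2 ⊤` (hole charts on the boosted Kerr exteriors of the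
REFERENCE parameters `(d.mass i, d.spin i)`) whose near zones converge in every `Cᵏ`, on fixed and on
growing slabs, to FROZEN sub-extremal members `(M i, a i)` measured in the same charts, yields a settled
`C²` system (a sub-extremal `FinalStateDecomposition d'` of `O' = exteriorOf charted(d')`, rays staying in
`closure O'`, exhaustive charts, orthochronous motions, the covector orientation clause and the flat `∂₀`
clause). In general this is NOT bookkeeping: a `FinalStateDecomposition` with masses `M i` and spins
`a i` carries its hole charts on `boostedKerrExterior Λᵢ cᵢ (M i) (a i)`, a different open set from the
reference domain unless `(M i, |a i|) = (d.mass i, |d.spin i|)` (nested confocal-ellipsoid exteriors), so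
`charted`, `O = J⁺(Σ) ∩ I⁻(charted)` and `RaysStayInClosure O` change and the causal structure of the
development near the event horizons is needed.

This file proves the SAME-PARAMETER case `dyadicCapture_honestRechart_of_sameParams`: the registered
signature with the single extra hypothesis `∀ i, M i = d.mass i ∧ a i = d.spin i` (inserted right after
the sub-extremality hypothesis). Then the window background
`{d.background i with bilin := boostedKerrBilin Λᵢ cᵢ (M i) (a i)}` IS `d.background i` (structure eta),
the two convergence hypotheses at `k = 2` are exactly the two convergence fields of
`FinalStateDecomposition`, and `d' := d.toFinalStateDecomposition h₁ h₂`
(`QuasiFinalStateDecomposition.toFinalStateDecomposition`) has the same charts: `charted`, `certifiedLate`,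
`certifiedSlab` agree by `rfl` (`toFinalStateDecomposition_charted/_certifiedLate/_certifiedSlab`), so with
`O' := O` every clause of the conclusion is, verbatim, a hypothesis. Pure bookkeeping over
`QuasiFinalStateDecomposition.lean`, `KerrConvergence.lean` and `Statement.lean`; sources of the notions:
Dafermos–Luk arXiv:1710.01722, Conjecture 1 (b)–(c); Klainerman–Szeftel, AMS-210, §1.2 (orbital versus
asymptotic stability in a fixed gauge).
-/

-- the `Summit.FinalStateConjecture.FinalStateConjecture.…` namespace repeats the summit = sub-problem
-- segment (D-0017); deliberate.
set_option linter.dupNamespace false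

noncomputable section

namespace Summit.FinalStateConjecture.FinalStateConjecture.Theorems

open Literature.Geometry.Lorentzian
open scoped Topology Manifold ENNReal ContDiff
open Filter Set

/-- The window background of hole `i` at the REFERENCE parameters is the reference background itself:
`{d.background i with bilin := boostedKerrBilin Λᵢ cᵢ (d.mass i) (d.spin i)} = d.background i`
(structure eta for `ModelBackground`; `d.background i = boostedKerrBackground Λᵢ cᵢ (d.mass i) (d.spin i)`
whose `bilin` field is `boostedKerrBilin Λᵢ cᵢ (d.mass i) (d.spin i)`). [folklore] -/
theorem QuasiFinalStateDecomposition.background_with_bilin_self {𝓢 : Spacetime.{0} 4}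
    {O : Set 𝓢.carrier} {k : ℕ} {ε : ℝ≥0∞} (d : QuasiFinalStateDecomposition 𝓢 O k ε) (i : Fin d.N) :
    ({d.background i with
        bilin := boostedKerrBilin (d.motion i).1 (d.motion i).2 (d.mass i) (d.spin i)} :
      ModelBackground) = d.background i :=
  rfl

/-- **Honest rechart, same-parameter case** (helper for the stub `stub_honestRechart` of the line
`registered` of the crux `DyadicCapture`): the registered signature of `stub_honestRechart` with the extra
hypothesis `∀ i, M i = d.mass i ∧ a i = d.spin i`. If the frozen sub-extremal members coincide with the
reference parameters of the honest era system `d`, then the `C²` convergence hypotheses (fixed slabs, all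
`ρ`; flat slabs) are the two convergence fields of `FinalStateDecomposition` IN THE SAME CHARTS, so
`d' := d.toFinalStateDecomposition h₁ h₂` with `O' := O` is the settled system: sub-extremality is the
hypothesis `|a i| < M i`; `charted`, `certifiedLate`, `certifiedSlab`, `background`, `chart`, `motion`,
`flatChart` of `d'` are those of `d` by `rfl`, so `O' = exteriorOf charted(d')`, `RaysStayInClosure O'`,
`HasExhaustiveCharts d'` (with the given honest radii `R`, the growing-slab convergence at `k = 2` and the
exhaustion clause), orthochronous motions, the covector clause and the flat `∂₀` clause are the hypotheses
verbatim. The general case (frozen parameters different from the reference ones) is not bookkeeping (module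
docstring). [cite: DafermosLuk2017, Conjecture 1 (b)–(c)] -/
theorem dyadicCapture_honestRechart_of_sameParams :
    ∀ (X : Type) [TopologicalSpace X] [ChartedSpace E3 X] [IsManifold (𝓡 3) ((⊤ : ℕ∞) : WithTop ℕ∞) X] [T2Space X] [SecondCountableTopology X] [ConnectedSpace X], ∀ D ∈ admissibleVacuumData X, ∀ 𝒟 : VacuumCauchyDevelopment D, 𝒟.IsMaximal → Summit.FinalStateConjecture.HasCompleteNullInfinity 𝒟.toCauchyDevelopment → ∀ (O : Set 𝒟.carrier) (d : QuasiFinalStateDecomposition 𝒟.toSpacetime O 2 ⊤) (R : Fin d.N → ℝ → ℝ) (M a : Fin d.N → ℝ), O = Summit.FinalStateConjecture.exteriorOf 𝒟.toCauchyDevelopment d.charted → Summit.FinalStateConjecture.RaysStayInClosure 𝒟.toCauchyDevelopment O → (∀ i : Fin d.N, Filter.Tendsto (R i) Filter.atTop Filter.atTop ∧ ∀ τ : ℝ, max (Kerr.rPlus (d.mass i) (d.spin i)) 0 + 1 ≤ R i τ) → (∀ τ₁ : ℝ, d.τ₀ < τ₁ → O \ d.certifiedLate R τ₁ ⊆ 𝒟.metric.causalPast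 𝒟.timeOrientation (d.certifiedSlab R τ₁)) → (∀ i : Fin d.N, Summit.FinalStateConjecture.IsOrthochronous (d.motion i).1) → (∀ (i : Fin d.N) (ρ : ℝ), ∀ᶠ τ in Filter.atTop, ∀ x ∈ (d.background i).truncTimeSlab ρ τ, ∀ w : E4, 𝒟.timeOrientation.IsFutureDirected (mfderiv 𝓘(ℝ, E4) (𝓡 4) (d.chart i) x w) → 0 < ((d.motion i).1 : E4 ≃L[ℝ] E4).symm w 0) → (∀ᶠ τ in Filter.atTop, ∀ x ∈ (Minkowski.backgroundOn d.flatDomain).timeSlab τ, 𝒟.timeOrientation.IsFutureDirected (mfderiv 𝓘(ℝ, E4) (𝓡 4) d.flatChart x (E4.basisVector 0))) → (∀ k : ℕ, Filter.Tendsto (fun τ => 𝒟.toSpacetime.deviationCk (Minkowski.backgroundOn d.flatDomain) d.flatChart k τ) Filter.atTop (nhds 0)) → (∀ i : Fin d.N, 0 < M i ∧ |a i| < M i) → (∀ i : Fin d.N, M i = d.mass i ∧ a i = d.spin i) → (∀ (i : Fin d.N) (k : ℕ) (ρ : ℝ), Filter.Tendsto (fun τ => 𝒟.toSpacetime.truncDeviationCk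 {d.background i with bilin := boostedKerrBilin (d.motion i).1 (d.motion i).2 (M i) (a i)} (d.chart i) k ρ τ) Filter.atTop (nhds 0)) → (∀ (i : Fin d.N) (k : ℕ), Filter.Tendsto (fun τ => 𝒟.toSpacetime.truncDeviationCk {d.background i with bilin := boostedKerrBilin (d.motion i).1 (d.motion i).2 (M i) (a i)} (d.chart i) k (R i τ) τ) Filter.atTop (nhds 0)) → ∃ (O' : Set 𝒟.carrier) (d' : FinalStateDecomposition 𝒟.toSpacetime O' 2), (∀ i, Kerr.IsSubextremal (d'.mass i) (d'.spin i)) ∧ O' = Summit.FinalStateConjecture.exteriorOf 𝒟.toCauchyDevelopment d'.charted ∧ Summit.FinalStateConjecture.RaysStayInClosure 𝒟.toCauchyDevelopment O' ∧ Summit.FinalStateConjecture.HasExhaustiveCharts d' ∧ (∀ i : Fin d'.N, Summit.FinalStateConjecture.IsOrthochronous (d'.motion i).1) ∧ (∀ (i : Fin d'.N) (ρ : ℝ), ∀ᶠ τ in Filter.atTop, ∀ x ∈ (d'.background i).truncTimeSlab ρ τ, ∀ w : E4, 𝒟.timeOrientation.IsFutureDirected (mfderiv 𝓘(ℝ, E4)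 (𝓡 4) (d'.chart i) x w) → 0 < ((d'.motion i).1 : E4 ≃L[ℝ] E4).symm w 0) ∧ (∀ᶠ τ in Filter.atTop, ∀ x ∈ (Minkowski.backgroundOn d'.flatDomain).timeSlab τ, 𝒟.timeOrientation.IsFutureDirected (mfderiv 𝓘(ℝ, E4) (𝓡 4) d'.flatChart x (E4.basisVector 0))) := by
  intro X _ _ _ _ _ _ D _hD 𝒟 _hmax _hI O d R M a hO hrays hR hexh horth hcov hflat0 hflat hsub hsame
    hfix hgrow
  -- the frozen members ARE the reference parameters
  obtain rfl : M = d.mass := funext fun i => (hsame i).1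
  obtain rfl : a = d.spin := funext fun i => (hsame i).2
  -- the window backgrounds at the reference parameters are the reference backgrounds
  simp only [QuasiFinalStateDecomposition.background_with_bilin_self] at hfix hgrow
  -- the two convergence fields of `FinalStateDecomposition`, in the same charts, at `k = 2`
  have h₁ : ∀ (i : Fin d.N) (ρ : ℝ), Tendsto
      (fun τ => 𝒟.toSpacetime.truncDeviationCk (d.background i) (d.chart i) 2 ρ τ) atTop (𝓝 0) :=
    fun i ρ => hfix i 2 ρ
  have h₂ : Tendsto (fun τ => 𝒟.toSpacetime.deviationCk (Minkowski.backgroundOn d.flatDomain)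
      d.flatChart 2 τ) atTop (𝓝 0) := hflat 2
  refine ⟨O, d.toFinalStateDecomposition h₁ h₂, fun i => (hsub i).2, hO, hrays, ?_, horth, hcov, hflat0⟩
  -- exhaustive charts: the given honest radii, growing-slab convergence at `k = 2`, the exhaustion clause
  exact ⟨R, hR, fun i => hgrow i 2, hexh⟩

end Summit.FinalStateConjecture.FinalStateConjecture.Theorems

end
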